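import Summits.KontsevichZagierPeriods.KontsevichZagierPeriods.Theses.FurushoPentagon
import Literature.NumberTheory.Transcendental.KZProductIdeal
import Literature.NumberTheory.Transcendental.KZUnfolding
import Literature.NumberTheory.Transcendental.KZLogCalculusProofs
import Literature.NumberTheory.Transcendental.MZVWordShuffle
import Literature.NumberTheory.Transcendental.MZVSimplexRepProofs
import Literature.NumberTheory.Transcendental.SemialgebraicMapsProofs

/-!
# `HoffmanRelationInKZ`, line `dilation-homotopy-transposition`: the two Newton–Leibniz descents

Stub `stub_descents` of the crux `HoffmanRelationInKZ` (stmt-KontsevichZagierPeriods-3930, route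
FurushoPentagon).  Coordinates on `ℝⁿ⁺²`: `u = z 0`, `x = Fin.tail (Fin.init z)` (so `x₀ = z 1`),
`λ = z (Fin.last (n + 1))`; the peak kernel is `W z = K (σ λ x) / (1 − u)` and its primitive along
`λ` is `F z = λ · f (σ λ x) / (1 − u)` (`σ c` is the shear `x₀ ↦ c x₀`).

* `descents_closeBand`: the shared bookkeeping.  An OPEN sub-band `R` of the closed band
  `{(y, t) | y ∈ τ, a y ≤ t ≤ b y}` over a base representation `rb` with null complement is first
  closed (one domain-additivity move plus a null representation) and then descended onto `rb` by
  ONE `KZ.newtonLeibnizRel` move with primitive `F`.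
* `descents_shuffle` (A): transposed peak `[{u < x₀} ⊂ (0,1)ⁿ⁺², W]` minus shuffle side
  `[{u < x₀} ⊂ (0,1)ⁿ⁺¹, f(x)/(1−u)]`: band `0 ≤ λ ≤ 1`, `F(1) − F(0) = f(x)/(1−u)`.
* `descents_stuffle` (B): peak `[{u < λ} ⊂ (0,1)ⁿ⁺², W]` minus stuffle side
  `[(0,1)ⁿ⁺¹, (f(x) − u f(σ u x))/(1−u)]`: band `u ≤ λ ≤ 1`, `F(1) − F(u)` is the difference
  quotient whole.

Everything about `f`, `K` is abstract: only the shear formula and the dilation calculus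
(fibrewise `HasDerivAt`/`ContinuousOn` and semialgebraicity on the big band) are used.

References: M. Kontsevich, D. Zagier, *Periods* (2001), §1.2 rule (3).
-/

noncomputable section

open Set MeasureTheory
open Literature.NumberTheory.Transcendental
open Literature.ModelTheory.ExponentialFields (IsSemialgebraic isSemialgebraic_univ)

namespace Summit.KontsevichZagierPeriods.FurushoPentagon.HoffmanRelationInKZ

/-- **Closing an open band and descending by Newton–Leibniz.**  Let `rb` be a base representation
in dimension `m`, `a ≤ b` semialgebraic edges on its domain, `W` (kernel) and `F` (primitive)
semialgebraic on the closed band `KZlog.band rb.domain a b`, with `t ↦ F (y, t)` continuous on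
`[a y, b y]` and differentiable with derivative `W (y, t)` on `(a y, b y)`, and
`rb.integrand y = F (y, b y) − F (y, a y)` on the base.  If `R` is a representation whose domain is
a subset of the band with NULL complement and whose integrand agrees with `W` on it, then
`[R] − [rb] ∈ KZ.relations`: `[band, W]` is a representation (integrable since the band is `R.domain`
up to a null set), `[band] − [R] − [band ∖ R] ∈ domainAddRel`, `[band ∖ R]` is null, and
`[band, W] − [rb] ∈ newtonLeibnizRel`. [cite: KontsevichZagier2001, §1.2 rule (3)] -/
theorem descents_closeBand {m : ℕ} (R : KZ.IntegralRep (m + 1)) (rb : KZ.IntegralRep m)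
    (a b : (Fin m → ℝ) → ℝ) (W F : (Fin (m + 1) → ℝ) → ℝ)
    (ha : IsSemialgebraicFunOn ℚ rb.domain a) (hb : IsSemialgebraicFunOn ℚ rb.domain b)
    (hab : ∀ x ∈ rb.domain, a x ≤ b x)
    (hW : IsSemialgebraicFunOn ℚ (KZlog.band rb.domain a b) W)
    (hF : IsSemialgebraicFunOn ℚ (KZlog.band rb.domain a b) F)
    (hcont : ∀ x ∈ rb.domain, ContinuousOn (fun t : ℝ => F (Fin.snoc x t)) (Icc (a x) (b x)))
    (hder : ∀ x ∈ rb.domain, ∀ t ∈ Ioo (a x) (b x),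
      HasDerivAt (fun s : ℝ => F (Fin.snoc x s)) (W (Fin.snoc x t)) t)
    (hbase : ∀ x ∈ rb.domain, rb.integrand x = F (Fin.snoc x (b x)) - F (Fin.snoc x (a x)))
    (hRsub : R.domain ⊆ KZlog.band rb.domain a b) (hRW : EqOn R.integrand W R.domain)
    (hnull : volume (KZlog.band rb.domain a b \ R.domain) = 0) :
    KZ.of R - KZ.of rb ∈ KZ.relations := by
  have hband : IsSemialgebraic ℚ (KZlog.band rb.domain a b) := KZlog.isSemialgebraic_band ha hb
  have hRm : MeasurableSet R.domain := KZ.IntegralRep.measurableSet_domain_holds R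
  have hWR : IntegrableOn W R.domain := R.integrableOn.congr_fun hRW hRm
  have hWband : IntegrableOn W (KZlog.band rb.domain a b) :=
    hWR.mono_set_ae (ae_le_set.mpr hnull)
  -- the closed band and its null collar
  set Rc : KZ.IntegralRep (m + 1) := ⟨KZlog.band rb.domain a b, W, hband, hW, hWband⟩ with hRc
  set Rf : KZ.IntegralRep (m + 1) := Rc.restrict (KZlog.band rb.domain a b \ R.domain)
    (hband.diff R.isSemialgebraic_domain) Set.sdiff_subset with hRf
  have h1 : KZ.of Rc - KZ.of R - KZ.of Rf ∈ KZ.relations := by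
    refine KZ.domainAddRel_subset_relations ⟨m + 1, Rc, R, Rf, ?_, ?_,
      fun z hz => (hRW hz).symm, fun _ _ => rfl, rfl⟩
    · change KZlog.band rb.domain a b = R.domain ∪ (KZlog.band rb.domain a b \ R.domain)
      rw [Set.union_sdiff_cancel hRsub]
    · change volume (R.domain ∩ (KZlog.band rb.domain a b \ R.domain)) = 0
      rw [Set.inter_sdiff_self, measure_empty]
  have h2 : KZ.of Rf ∈ KZ.relations := KZ.of_mem_relations_of_volume_eq_zero Rf hnull
  have h3 : KZ.of Rc - KZ.of rb ∈ KZ.relations :=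
    KZ.newtonLeibnizRel_subset_relations
      ⟨m, Rc, rb, a, b, F, hF, ha, hb, hab, rfl, hcont, hder, hbase, rfl⟩
  have : KZ.of R - KZ.of rb =
      (KZ.of Rc - KZ.of rb) - (KZ.of Rc - KZ.of R - KZ.of Rf) - KZ.of Rf := by abel
  rw [this]
  exact KZ.relations.sub_mem (KZ.relations.sub_mem h3 h1) h2

/-- Coordinates of a fibre point `Fin.snoc y t ∈ ℝⁿ⁺²` over `y ∈ ℝⁿ⁺¹`: the last coordinate is `t`,
the `0`-th is `y 0`, and `Fin.tail (Fin.init _) = Fin.tail y`. [folklore] -/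
theorem descents_snoc_coord {n : ℕ} (y : Fin (n + 1) → ℝ) (t : ℝ) :
    (Fin.snoc y t : Fin (n + 2) → ℝ) (Fin.last (n + 1)) = t ∧
    (Fin.snoc y t : Fin (n + 2) → ℝ) 0 = y 0 ∧
    Fin.tail (Fin.init (Fin.snoc y t : Fin (n + 2) → ℝ)) = Fin.tail y := by
  refine ⟨Fin.snoc_last _ _, ?_, by rw [Fin.init_snoc]⟩
  exact Fin.snoc_castSucc (α := fun _ : Fin (n + 2) => ℝ) t y 0

/-- Every index of `Fin (n + 2)` is either a `Fin.castSucc` or the last one; membership of all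
coordinates in `(0,1)` splits accordingly. [folklore] -/
theorem descents_forall_mem_Ioo {n : ℕ} {z : Fin (n + 2) → ℝ}
    (hinit : ∀ i : Fin (n + 1), Fin.init z i ∈ Ioo (0:ℝ) 1)
    (hlast : z (Fin.last (n + 1)) ∈ Ioo (0:ℝ) 1) : ∀ i, z i ∈ Ioo (0:ℝ) 1 := by
  intro i
  rcases Fin.eq_castSucc_or_eq_last i with ⟨j, rfl⟩ | rfl
  · exact hinit j
  · exact hlast

/-- **Descent (A): transposed peak onto the shuffle side.**  For `n ≥ 1` and abstract `f, K, σ`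
with the shear formula and the dilation calculus: every transposed peak
`[{u < x₀} ⊂ (0,1)ⁿ⁺², K(σ λ x)/(1−u)]` minus every shuffle side `[{u < x₀} ⊂ (0,1)ⁿ⁺¹, f(x)/(1−u)]`
is a KZ relation — close the band `λ ∈ [0, 1]` by the two null faces `{λ = 0}`, `{λ = 1}` and apply
one Newton–Leibniz move with `a = 0`, `b = 1`, primitive `F = λ f(σ λ x)/(1−u)`,
`F(1) − F(0) = f(x)/(1−u)`. [cite: KontsevichZagier2001, §1.2 rule (3)] -/
theorem descents_shuffle {n : ℕ} (hn : 1 ≤ n) (f K : (Fin n → ℝ) → ℝ)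
    (σ : ℝ → (Fin n → ℝ) → (Fin n → ℝ))
    (hσ : ∀ (c : ℝ) (x : Fin n → ℝ) (j : Fin n), σ c x j = if (j : ℕ) = 0 then c * x j else x j)
    (h1 : ∀ x : Fin n → ℝ, (∀ i, x i ∈ Ioo (0:ℝ) 1) → ∀ l ∈ Ioo (0:ℝ) 1,
      HasDerivAt (fun l : ℝ => l * f (σ l x)) (K (σ l x)) l)
    (h2 : ∀ x : Fin n → ℝ, (∀ i, x i ∈ Ioo (0:ℝ) 1) →
      ContinuousOn (fun l : ℝ => l * f (σ l x)) (Icc 0 1))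
    (h5 : IsSemialgebraicFunOn ℚ {z : Fin (n + 2) → ℝ | (∀ i, Fin.init z i ∈ Ioo (0:ℝ) 1) ∧
        0 ≤ z (Fin.last (n + 1)) ∧ z (Fin.last (n + 1)) ≤ 1}
      (fun z => K (σ (z (Fin.last (n + 1))) (Fin.tail (Fin.init z))) / (1 - z 0)))
    (h6 : IsSemialgebraicFunOn ℚ {z : Fin (n + 2) → ℝ | (∀ i, Fin.init z i ∈ Ioo (0:ℝ) 1) ∧
        0 ≤ z (Fin.last (n + 1)) ∧ z (Fin.last (n + 1)) ≤ 1}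
      (fun z => z (Fin.last (n + 1)) * f (σ (z (Fin.last (n + 1))) (Fin.tail (Fin.init z))) /
        (1 - z 0)))
    (r : KZ.IntegralRep (n + 1)) (R : KZ.IntegralRep (n + 2))
    (hr : r.domain = {y : Fin (n + 1) → ℝ | (∀ i, y i ∈ Ioo (0:ℝ) 1) ∧ y 0 < y 1} ∧
      EqOn r.integrand (fun y => f (Fin.tail y) / (1 - y 0)) r.domain)
    (hR : R.domain = {z : Fin (n + 2) → ℝ | (∀ i, z i ∈ Ioo (0:ℝ) 1) ∧ z 0 < z 1} ∧
      EqOn R.integrand (fun z => K (σ (z (Fin.last (n + 1))) (Fin.tail (Fin.init z))) / (1 - z 0))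
        R.domain) :
    KZ.of R - KZ.of r ∈ KZ.relations := by
  obtain ⟨hrd, hri⟩ := hr
  obtain ⟨hRd, hRi⟩ := hR
  have hc1 : (Fin.castSucc (1 : Fin (n + 1)) : Fin (n + 2)) = 1 := Fin.ext (by
    rw [Fin.val_castSucc, Fin.val_one', Fin.val_one, Nat.mod_eq_of_lt (by omega)])
  have hinit1 : ∀ z : Fin (n + 2) → ℝ, Fin.init z 1 = z 1 := fun z => by
    show z (Fin.castSucc 1) = z 1
    rw [hc1]
  have hσ1 : ∀ x, σ 1 x = x := fun x => funext fun j => by simp [hσ]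
  -- the primitive and the kernel
  set W : (Fin (n + 2) → ℝ) → ℝ :=
    fun z => K (σ (z (Fin.last (n + 1))) (Fin.tail (Fin.init z))) / (1 - z 0) with hW_def
  set F : (Fin (n + 2) → ℝ) → ℝ := fun z => z (Fin.last (n + 1)) *
    f (σ (z (Fin.last (n + 1))) (Fin.tail (Fin.init z))) / (1 - z 0) with hF_def
  have hFs : ∀ (y : Fin (n + 1) → ℝ) (t : ℝ),
      F (Fin.snoc y t) = t * f (σ t (Fin.tail y)) / (1 - y 0) := fun y t => by
    obtain ⟨hl, h0, ht⟩ := descents_snoc_coord y t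
    simp only [hF_def, hl, h0, ht]
  have hWs : ∀ (y : Fin (n + 1) → ℝ) (t : ℝ),
      W (Fin.snoc y t) = K (σ t (Fin.tail y)) / (1 - y 0) := fun y t => by
    obtain ⟨hl, h0, ht⟩ := descents_snoc_coord y t
    simp only [hW_def, hl, h0, ht]
  -- the edges `a = 0`, `b = 1`
  set a : (Fin (n + 1) → ℝ) → ℝ := fun _ => 0 with ha_def
  set b : (Fin (n + 1) → ℝ) → ℝ := fun _ => 1 with hb_def
  have ha : IsSemialgebraicFunOn ℚ r.domain a :=
    (isSemialgebraicFunOn_aeval r.isSemialgebraic_domain 0).congr fun x _ => by simp [a]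
  have hb : IsSemialgebraicFunOn ℚ r.domain b :=
    (isSemialgebraicFunOn_aeval r.isSemialgebraic_domain 1).congr fun x _ => by simp [b]
  have hband : IsSemialgebraic ℚ (KZlog.band r.domain a b) := KZlog.isSemialgebraic_band ha hb
  have htail : ∀ y ∈ r.domain, ∀ i, Fin.tail y i ∈ Ioo (0:ℝ) 1 := fun y hy i => by
    rw [hrd] at hy
    exact hy.1 i.succ
  -- band ⊆ big band, open peak ⊆ band, null collar
  have hsub : KZlog.band r.domain a b ⊆ {z : Fin (n + 2) → ℝ | (∀ i, Fin.init z i ∈ Ioo (0:ℝ) 1) ∧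
      0 ≤ z (Fin.last (n + 1)) ∧ z (Fin.last (n + 1)) ≤ 1} := by
    rintro z ⟨hz, hz0, hz1⟩
    rw [hrd] at hz
    exact ⟨hz.1, hz0, hz1⟩
  have hRsub : R.domain ⊆ KZlog.band r.domain a b := by
    rintro z hz
    rw [hRd] at hz
    refine ⟨?_, (hz.1 _).1.le, (hz.1 _).2.le⟩
    rw [hrd]
    refine ⟨fun i => hz.1 _, ?_⟩
    rw [hinit1]
    exact hz.2
  have hnull : volume (KZlog.band r.domain a b \ R.domain) = 0 := by
    refine measure_mono_null ?_
      (measure_union_null (KZ.volume_setOf_last_eq_zero (n := n + 1) 0)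
        (KZ.volume_setOf_last_eq_zero (n := n + 1) 1))
    rintro z ⟨⟨hz, hz0, hz1⟩, hzR⟩
    by_contra hne
    simp only [mem_union, mem_setOf_eq, not_or] at hne
    apply hzR
    rw [hrd] at hz
    rw [hRd]
    refine ⟨descents_forall_mem_Ioo hz.1 ⟨lt_of_le_of_ne hz0 (Ne.symm hne.1),
      lt_of_le_of_ne hz1 hne.2⟩, ?_⟩
    have := hz.2
    rwa [hinit1] at this
  refine descents_closeBand R r a b W F ha hb (fun _ _ => zero_le_one) (h5.mono hsub hband)
    (h6.mono hsub hband) ?_ ?_ ?_ hRsub hRi hnull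
  · -- fibrewise continuity on `[0, 1]`
    intro y hy
    have : (fun t : ℝ => F (Fin.snoc y t)) = fun t => t * f (σ t (Fin.tail y)) / (1 - y 0) :=
      funext fun t => hFs y t
    rw [this]
    exact (h2 _ (htail y hy)).div_const _
  · -- fibrewise derivative on `(0, 1)`
    intro y hy t ht
    have : (fun s : ℝ => F (Fin.snoc y s)) = fun s => s * f (σ s (Fin.tail y)) / (1 - y 0) :=
      funext fun s => hFs y s
    rw [this, hWs]
    exact (h1 _ (htail y hy) t ht).div_const _
  · -- the base identity `F(1) − F(0) = f(x)/(1−u)`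
    intro y hy
    rw [hri hy, hFs, hFs]
    simp [ha_def, hb_def, hσ1]

/-- **Descent (B): peak onto the stuffle side.**  For abstract `f, K, σ` with the shear formula and
the dilation calculus: every peak `[{u < λ} ⊂ (0,1)ⁿ⁺², K(σ λ x)/(1−u)]` minus every stuffle side
`[(0,1)ⁿ⁺¹, (f(x) − u f(σ u x))/(1−u)]` is a KZ relation — close the band `u ≤ λ ≤ 1` by the null
faces `{λ = u}` (a graph) and `{λ = 1}` and apply one Newton–Leibniz move with `a = u`, `b = 1`,
primitive `F = λ f(σ λ x)/(1−u)`: `F(1) − F(u)` is the difference quotient whole.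
[cite: KontsevichZagier2001, §1.2 rule (3)] -/
theorem descents_stuffle {n : ℕ} (f K : (Fin n → ℝ) → ℝ) (σ : ℝ → (Fin n → ℝ) → (Fin n → ℝ))
    (hσ : ∀ (c : ℝ) (x : Fin n → ℝ) (j : Fin n), σ c x j = if (j : ℕ) = 0 then c * x j else x j)
    (h1 : ∀ x : Fin n → ℝ, (∀ i, x i ∈ Ioo (0:ℝ) 1) → ∀ l ∈ Ioo (0:ℝ) 1,
      HasDerivAt (fun l : ℝ => l * f (σ l x)) (K (σ l x)) l)
    (h2 : ∀ x : Fin n → ℝ, (∀ i, x i ∈ Ioo (0:ℝ) 1) →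
      ContinuousOn (fun l : ℝ => l * f (σ l x)) (Icc 0 1))
    (h5 : IsSemialgebraicFunOn ℚ {z : Fin (n + 2) → ℝ | (∀ i, Fin.init z i ∈ Ioo (0:ℝ) 1) ∧
        0 ≤ z (Fin.last (n + 1)) ∧ z (Fin.last (n + 1)) ≤ 1}
      (fun z => K (σ (z (Fin.last (n + 1))) (Fin.tail (Fin.init z))) / (1 - z 0)))
    (h6 : IsSemialgebraicFunOn ℚ {z : Fin (n + 2) → ℝ | (∀ i, Fin.init z i ∈ Ioo (0:ℝ) 1) ∧
        0 ≤ z (Fin.last (n + 1)) ∧ z (Fin.last (n + 1)) ≤ 1}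
      (fun z => z (Fin.last (n + 1)) * f (σ (z (Fin.last (n + 1))) (Fin.tail (Fin.init z))) /
        (1 - z 0)))
    (r : KZ.IntegralRep (n + 1)) (R : KZ.IntegralRep (n + 2))
    (hr : r.domain = {y : Fin (n + 1) → ℝ | ∀ i, y i ∈ Ioo (0:ℝ) 1} ∧
      EqOn r.integrand (fun y => (f (Fin.tail y) - y 0 * f (σ (y 0) (Fin.tail y))) / (1 - y 0))
        r.domain)
    (hR : R.domain = {z : Fin (n + 2) → ℝ | (∀ i, z i ∈ Ioo (0:ℝ) 1) ∧
        z 0 < z (Fin.last (n + 1))} ∧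
      EqOn R.integrand (fun z => K (σ (z (Fin.last (n + 1))) (Fin.tail (Fin.init z))) / (1 - z 0))
        R.domain) :
    KZ.of R - KZ.of r ∈ KZ.relations := by
  obtain ⟨hrd, hri⟩ := hr
  obtain ⟨hRd, hRi⟩ := hR
  have hinit0 : ∀ z : Fin (n + 2) → ℝ, Fin.init z 0 = z 0 := fun z => rfl
  have hσ1 : ∀ x, σ 1 x = x := fun x => funext fun j => by simp [hσ]
  -- the primitive and the kernel
  set W : (Fin (n + 2) → ℝ) → ℝ :=
    fun z => K (σ (z (Fin.last (n + 1))) (Fin.tail (Fin.init z))) / (1 - z 0) with hW_def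
  set F : (Fin (n + 2) → ℝ) → ℝ := fun z => z (Fin.last (n + 1)) *
    f (σ (z (Fin.last (n + 1))) (Fin.tail (Fin.init z))) / (1 - z 0) with hF_def
  have hFs : ∀ (y : Fin (n + 1) → ℝ) (t : ℝ),
      F (Fin.snoc y t) = t * f (σ t (Fin.tail y)) / (1 - y 0) := fun y t => by
    obtain ⟨hl, h0, ht⟩ := descents_snoc_coord y t
    simp only [hF_def, hl, h0, ht]
  have hWs : ∀ (y : Fin (n + 1) → ℝ) (t : ℝ),
      W (Fin.snoc y t) = K (σ t (Fin.tail y)) / (1 - y 0) := fun y t => by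
    obtain ⟨hl, h0, ht⟩ := descents_snoc_coord y t
    simp only [hW_def, hl, h0, ht]
  -- the edges `a = u`, `b = 1`
  set a : (Fin (n + 1) → ℝ) → ℝ := fun y => y 0 with ha_def
  set b : (Fin (n + 1) → ℝ) → ℝ := fun _ => 1 with hb_def
  have ha : IsSemialgebraicFunOn ℚ r.domain a :=
    (isSemialgebraicFunOn_aeval r.isSemialgebraic_domain (MvPolynomial.X 0)).congr
      fun x _ => by simp [a]
  have hb : IsSemialgebraicFunOn ℚ r.domain b :=
    (isSemialgebraicFunOn_aeval r.isSemialgebraic_domain 1).congr fun x _ => by simp [b]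
  have hband : IsSemialgebraic ℚ (KZlog.band r.domain a b) := KZlog.isSemialgebraic_band ha hb
  have htail : ∀ y ∈ r.domain, ∀ i, Fin.tail y i ∈ Ioo (0:ℝ) 1 := fun y hy i => by
    rw [hrd] at hy
    exact hy i.succ
  have h0 : ∀ y ∈ r.domain, y 0 ∈ Ioo (0:ℝ) 1 := fun y hy => by
    rw [hrd] at hy
    exact hy 0
  -- band ⊆ big band, open peak ⊆ band, null collar
  have hsub : KZlog.band r.domain a b ⊆ {z : Fin (n + 2) → ℝ | (∀ i, Fin.init z i ∈ Ioo (0:ℝ) 1) ∧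
      0 ≤ z (Fin.last (n + 1)) ∧ z (Fin.last (n + 1)) ≤ 1} := by
    rintro z ⟨hz, hz0, hz1⟩
    refine ⟨by rw [hrd] at hz; exact hz, ((h0 _ hz).1.le.trans hz0), hz1⟩
  have hRsub : R.domain ⊆ KZlog.band r.domain a b := by
    rintro z hz
    rw [hRd] at hz
    refine ⟨?_, hz.2.le, (hz.1 _).2.le⟩
    rw [hrd]
    exact fun i => hz.1 _
  have hgraph : IsSemialgebraicFunOn ℚ (univ : Set (Fin (n + 1) → ℝ)) (fun y => y 0) :=
    (isSemialgebraicFunOn_aeval isSemialgebraic_univ (MvPolynomial.X 0)).congr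
      fun x _ => by simp
  have hnull : volume (KZlog.band r.domain a b \ R.domain) = 0 := by
    refine measure_mono_null ?_
      (measure_union_null (KZ.volume_graph_eq_zero hgraph)
        (KZ.volume_setOf_last_eq_zero (n := n + 1) 1))
    rintro z ⟨⟨hz, hz0, hz1⟩, hzR⟩
    by_contra hne
    simp only [mem_union, mem_setOf_eq, mem_univ, true_and, not_or] at hne
    apply hzR
    have hu := h0 _ hz
    rw [hrd] at hz
    rw [hRd]
    have hlt : z 0 < z (Fin.last (n + 1)) := lt_of_le_of_ne hz0 (Ne.symm hne.1)
    exact ⟨descents_forall_mem_Ioo hz ⟨hu.1.trans hlt, lt_of_le_of_ne hz1 hne.2⟩, hlt⟩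
  refine descents_closeBand R r a b W F ha hb (fun y hy => (h0 y hy).2.le) (h5.mono hsub hband)
    (h6.mono hsub hband) ?_ ?_ ?_ hRsub hRi hnull
  · -- fibrewise continuity on `[u, 1]`
    intro y hy
    have : (fun t : ℝ => F (Fin.snoc y t)) = fun t => t * f (σ t (Fin.tail y)) / (1 - y 0) :=
      funext fun t => hFs y t
    rw [this]
    exact ((h2 _ (htail y hy)).div_const _).mono (Icc_subset_Icc (h0 y hy).1.le le_rfl)
  · -- fibrewise derivative on `(u, 1)`
    intro y hy t ht
    have : (fun s : ℝ => F (Fin.snoc y s)) = fun s => s * f (σ s (Fin.tail y)) / (1 - y 0) :=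
      funext fun s => hFs y s
    rw [this, hWs]
    exact (h1 _ (htail y hy) t ⟨(h0 y hy).1.trans ht.1, ht.2⟩).div_const _
  · -- the base identity `F(1) − F(u) = (f(x) − u f(σ u x))/(1−u)`
    intro y hy
    rw [hri hy, hFs, hFs]
    simp only [ha_def, hb_def, hσ1, one_mul, sub_div]

/-- Admissible non-empty indices have weight `≥ 1` (indeed `≥ 2`). [folklore] -/
theorem descents_one_le_weight {s : List ℕ} (hs : MZV.IsAdmissible s) (hne : s ≠ []) :
    1 ≤ MZV.weight s := by
  obtain ⟨a, t, rfl⟩ := List.exists_cons_of_ne_nil hne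
  have ha : 2 ≤ a := hs.2 (List.cons_ne_nil a t)
  simp only [MZV.weight, List.sum_cons]
  omega

/-- STUB (the two Newton–Leibniz descents).  For a non-empty admissible `s`, granted the dilation calculus:
(A) every transposed peak `[{u < x₀} ⊂ (0,1)ⁿ⁺², K_s(λx₀,x')/(1−u)]` minus every shuffle side
`[{u < x₀} ⊂ (0,1)ⁿ⁺¹, f_s(x)/(1−u)]` is a relation: close the band in `λ ∈ [0,1]` (null faces,
`KZ.of_mem_levelRel_of_volume_eq_zero` + domain additivity), then ONE `KZ.newtonLeibnizRel` instance along the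
last coordinate with `a = 0`, `b = 1`, primitive `F = λ f_s(λx₀,x')/(1−u)`, `F(1) − F(0) = f_s(x)/(1−u)`;
(B) every peak `[{u < λ}, K_s(λx₀,x')/(1−u)]` minus every stuffle side `[(0,1)ⁿ⁺¹, (f_s(x) − u f_s(ux₀,x'))/(1−u)]`
is a relation: band `a(u,x) = u ≤ λ ≤ 1 = b`, same primitive, `F(1) − F(u)` = the difference quotient WHOLE.
[cite: KontsevichZagier2001, §1.2 rule (3)] -/
theorem stub_descents : ∀ (s : List ℕ), MZV.IsAdmissible s → s ≠ [] → ∀ (f : (Fin (MZV.weight s) → ℝ) → ℝ) (K : (Fin (MZV.weight s) → ℝ) → ℝ) (σ : ℝ → (Fin (MZV.weight s) → ℝ) → (Fin (MZV.weight s) → ℝ)), (∀ (c : ℝ) (x : Fin (MZV.weight s) → ℝ) (j : Fin (MZV.weight s)), σ c x j = if (j : ℕ) = 0 then c * x j else x j) → ((∀ x : Fin (MZV.weight s) → ℝ, (∀ i, x i ∈ Set.Ioo (0:ℝ) 1) → ∀ l ∈ Set.Ioo (0:ℝ) 1, HasDerivAt (fun l : ℝ => l * f (σ l x)) (K (σ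 l x)) l) ∧ (∀ x : Fin (MZV.weight s) → ℝ, (∀ i, x i ∈ Set.Ioo (0:ℝ) 1) → ContinuousOn (fun l : ℝ => l * f (σ l x)) (Set.Icc 0 1)) ∧ (∀ x : Fin (MZV.weight s) → ℝ, (∀ i, x i ∈ Set.Ioo (0:ℝ) 1) → ContinuousOn (fun l : ℝ => K (σ l x)) (Set.Icc 0 1)) ∧ (∀ x : Fin (MZV.weight s) → ℝ, (∀ i, x i ∈ Set.Ioo (0:ℝ) 1) → ∀ l ∈ Set.Icc (0:ℝ) 1, 0 ≤ K (σ l x)) ∧ IsSemialgebraicFunOn ℚ {z : Fin (MZV.weight s + 2) → ℝ | (∀ i, Fin.init z i ∈ Set.Ioo (0:ℝ) 1) ∧ 0 ≤ z (Fin.last (MZV.weight s + 1)) ∧ z (Fin.last (MZV.weight s + 1)) ≤ 1} (fun z => K (σ (z (Fin.last (MZV.weight s + 1))) (Fin.tail (Fin.init z))) / (1 - z 0)) ∧ IsSemialgebraicFunOn ℚ {z : Fin (MZV.weight s + 2) → ℝ | (∀ i, Fin.init z i ∈ Set.Ioo (0:ℝ) 1) ∧ 0 ≤ z (Fin.last (MZV.weight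 s + 1)) ∧ z (Fin.last (MZV.weight s + 1)) ≤ 1} (fun z => z (Fin.last (MZV.weight s + 1)) * f (σ (z (Fin.last (MZV.weight s + 1))) (Fin.tail (Fin.init z))) / (1 - z 0))) → (∀ (r : KZ.IntegralRep (MZV.weight s + 1)) (R : KZ.IntegralRep (MZV.weight s + 2)), (r.domain = {y : Fin (MZV.weight s + 1) → ℝ | (∀ i, y i ∈ Set.Ioo (0:ℝ) 1) ∧ y 0 < y 1} ∧ Set.EqOn r.integrand (fun y => f (Fin.tail y) / (1 - y 0)) r.domain) → (R.domain = {z : Fin (MZV.weight s + 2) → ℝ | (∀ i, z i ∈ Set.Ioo (0:ℝ) 1) ∧ z 0 < z 1} ∧ Set.EqOn R.integrand (fun z => K (σ (z (Fin.last (MZV.weight s + 1))) (Fin.tail (Fin.init z))) / (1 - z 0)) R.domain) → KZ.of R - KZ.of r ∈ KZ.relations) ∧ (∀ (r : KZ.IntegralRep (MZV.weight s + 1)) (R : KZ.IntegralRep (MZV.weight s + 2)), (r.domain = {y : Fin (MZV.weight s + 1) → ℝ | ∀ i, y i ∈ Set.Ioo (0:ℝ) 1} ∧ Set.EqOn r.integrand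 (fun y => (f (Fin.tail y) - y 0 * f (σ (y 0) (Fin.tail y))) / (1 - y 0)) r.domain) → (R.domain = {z : Fin (MZV.weight s + 2) → ℝ | (∀ i, z i ∈ Set.Ioo (0:ℝ) 1) ∧ z 0 < z (Fin.last (MZV.weight s + 1))} ∧ Set.EqOn R.integrand (fun z => K (σ (z (Fin.last (MZV.weight s + 1))) (Fin.tail (Fin.init z))) / (1 - z 0)) R.domain) → KZ.of R - KZ.of r ∈ KZ.relations) := by
  intro s hs hne f K σ hσ hcalc
  obtain ⟨h1, h2, -, -, h5, h6⟩ := hcalc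
  exact ⟨fun r R hr hR => descents_shuffle (descents_one_le_weight hs hne) f K σ hσ h1 h2 h5 h6 r R hr hR,
    fun r R hr hR => descents_stuffle f K σ hσ h1 h2 h5 h6 r R hr hR⟩

end Summit.KontsevichZagierPeriods.FurushoPentagon.HoffmanRelationInKZ
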